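import Literature.Computability.QuantumComplexity.QTMCircuitUniform
import Literature.Computability.Cryptography.QuantumTuringMachineUnidirectionSim
import Literature.Computability.QuantumComplexity.QuantumTuringPositionedGlue
import Literature.Computability.QuantumComplexity.UniformSubstitution
import Literature.Computability.QuantumComplexity.CliffordTUniversalityProofs
import Literature.Computability.Cryptography.ClassBQPAmplificationProofs
import Literature.Computability.QuantumComplexity.EffectiveCompilation
import Literature.Computability.QuantumComplexity.BQPOverPromise
import HarnessLib

/-!
# Uniform circuit families carry out quantum Turing machines (Nishimura–Ozawa 2002, Thm. 4.3, after Yao 1993), and `BQP(QTM) ⊆ BQP(circuits)`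

The sixth and last file of the formalisation (files `QTMCircuitGadgets`, `QTMCircuitLayout`,
`QTMCircuitGateSet`, `QTMCircuitStep`, `QTMCircuitDesc`, `QTMCircuitUniform`) of the simulation of
quantum Turing machines by quantum circuits in Bernstein–Vazirani's positioned model
(`Cryptography/QuantumTuringMachinePositioned.lean`), for UNIDIRECTIONAL machines
(Bernstein–Vazirani 1997, Def. 3.14; to which BV's unidirection lemma 5.5 reduces every machine).
It assembles the headline theorems, all proved, and the class-level consequences for the named
fact `Literature.Computability.QuantumComplexity.BQPQTM_eq_BQP` (quantum-advantage **S04**) in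
its faithful, positioned reading `BQPQTMPos = BQP` (`QuantumTuring.lean`, module docstring):

* **`qtm_uniformCircuitFamily_of_unidirectional`** — Nishimura–Ozawa 2002, Thm. 4.3 with §2.2
  (after Yao, FOCS 1993): for every unidirectional QTM `M` and polynomial `p` there is a
  polynomial-time uniform, oracle-free family of quantum circuits over the finite gate set
  `yaoGateSet M D = Clifford+T ∪ {G₁(M)}` whose acceptance probability on every input `x` EQUALS
  the probability that `M`, observed after exactly `p(|x|)` steps, is in its accepting state.
  When `M` is well formed in Bernstein–Vazirani's sense the gate set is unitary, and when the
  amplitudes of `M` are polynomial-time computable so are the entries of its gates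
  (`yaoGateSet_isUnitary_of_pIsWellFormed`, `yaoGateSet_polyTimeEntries`).
* **`mem_BQPWith_yaoGateSet`** — hence a language decided with bounded error by a unidirectional
  BV-well-formed machine is in `BQPWith (yaoGateSet M D) (1/3)`.
* **`BQPQTMPos_subset_BQP_of_unidirection_of_SK`** — Nishimura–Ozawa 2002, Thm. 5.2, inclusion `BQP ⊆ BUPQC`, in
  the tree's setting: from (i) the **unidirection lemma** (Bernstein–Vazirani 1997, Lemma 5.5:
  every BV-well-formed machine with polynomial-time computable amplitudes is carried out, up to a
  polynomial change of the observation time, by a unidirectional one — hypothesis `hUni`, not yet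
  in the tree) and (ii) the **effective Solovay–Kitaev theorem** in the form `hSK` of
  `BQPOver_eq_BQP_of` (`BQPGateSetIndependence.lean`, the one remaining hypothesis of the named
  fact `BQPOver_eq_BQP`, S26), one gets `BQPQTMPos ⊆ BQP`: compile `yaoGateSet M D` into
  Clifford+`T` along the compiler (`BQPWith_subset_BQPWith_of_compiler`, uniform substitution
  `GateCompiler.uniformSubst_of_polyTime`) and absorb the error (`BQP_eq_BQPWith_holds`).
* **`BQPQTMPos_eq_BQP_of_unidirection_SK_NO`** — with, for `⊇`, the positioned stationary form of
  Nishimura–Ozawa's Lemma 5.1 (`hNOpos` of `BQP_subset_BQPQTM_of_positioned`,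
  `QuantumTuringPositionedGlue.lean`): `BQPQTMPos = BQP`.

* **`BQPQTMPos_subset_BQP_of_SK`**, **`BQPQTMPos_eq_BQP_of_SK_NO`** — the same with `hUni`
  DISCHARGED by the tree theorem `QTM.unidirection`
  (`Cryptography/QuantumTuringMachineUnidirectionSim.lean`, Bernstein–Vazirani's Lemma 5.5 in the
  positioned model inside `C̃`): **`BQPQTMPos ⊆ BQP` now only waits for the effective
  Solovay–Kitaev compiler `hSK`** (the one remaining hypothesis of S26, `BQPOver_eq_BQP_of`), and
  `BQPQTMPos = BQP` for `hSK` and `hNOpos`.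

* **`BQPQTMPos_subset_BQP`** — UNCONDITIONAL: `hSK` too is discharged, by the tree's effective
  compiler `exists_sound_expTime_compiler` (`EffectiveCompilation.lean`) used at logarithmic
  accuracy level (`PromiseBQPWith_subset_of_expTime`, `LogLevelSubstitution.lean`) through the
  promise classes; `BQPQTMPos_eq_BQP_of_NO` — the faithful S04 from `hNOpos` alone.

Compared with the glue `BQPQTMPos_eq_BQP_of hYao hamp hNO` of `QuantumTuringProofs.lean`, the
simulation hypothesis `hYao` (QTMs → approximate Clifford+`T` families) is thus DISCHARGED up to
the printed effective Solovay–Kitaev theorem `hSK` (Dawson–Nielsen), `hUni` being proved here and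
`hamp` being the tree theorem `BQP_eq_BQPWith_holds`. No named fact is introduced.

## References

* A. C.-C. Yao, *Quantum circuit complexity*, Proc. 34th FOCS (1993) 352–361 [YaoFOCS1993].
* H. Nishimura, M. Ozawa, *Computational complexity of uniform quantum circuit families and
  quantum Turing machines*, Theoret. Comput. Sci. 276 (2002) 147–181 = arXiv:quant-ph/9906095
  [NishimuraOzawa2002]: §2.2, Thm. 4.3, Lemma 5.1, Thm. 5.2.
* E. Bernstein, U. Vazirani, *Quantum complexity theory*, SIAM J. Comput. 26 (1997) 1411–1473
  [BernsteinVaziraniSICOMP1997]: Def. 3.14, Lemma 5.5, §8.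
* C. M. Dawson, M. A. Nielsen, *The Solovay–Kitaev algorithm*, Quantum Inf. Comput. 6 (2006)
  81–95 [DawsonNielsen2006], Thm. 1.
-/

noncomputable section

namespace Literature.Computability.QuantumComplexity

open Cryptography QTM Turing YaoSim

/-- **Nishimura–Ozawa 2002, Thm. 4.3 (after Yao 1993), uniform form, for unidirectional machines
in Bernstein–Vazirani's model.** For every quantum Turing machine `M` that is unidirectional with
direction assignment `D` and every polynomial `p` there is a polynomial-time uniform, oracle-free
family `F` of quantum circuits over the finite gate set `yaoGateSet M D` (Clifford+`T` and the
local gate `G₁(M)` on `|Q| + |Σ|` qubits) such that for every input `x` the probability that `F`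
accepts `x` equals the probability that `M`, started on `x` and observed after exactly `p(|x|)`
steps, is in its accepting state (exact `t`-simulation, §4, and polynomial-time uniformity,
§2.2). The family is `YaoSim.yaoFamily M D p`. [cite: NishimuraOzawa2002, Thm. 4.3] -/
theorem qtm_uniformCircuitFamily_of_unidirectional (M : QTM) {D : M.Λ → Dir}
    (hD : M.IsUnidirectionalWith D) (p : Polynomial ℕ) :
    ∃ F : QCircuitFamily (yaoGateSet M D), F.IsOracleFree ∧ F.IsUniform ∧
      ∀ x : List Bool, F.acceptProbOn 0 x = M.pacceptProbAt x (p.eval x.length) :=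
  ⟨yaoFamily M D p, isOracleFree_yaoFamily D p, isUniform_yaoFamily M D p, acceptProbOn_yaoFamily D hD p⟩

/-- **Bounded-error languages of unidirectional machines are in `BQPWith (yaoGateSet M D) (1/3)`**:
if `M` (unidirectional with `D`) decides `L` with thresholds `2/3`, `1/3` when observed after
`p(|x|)` steps in the positioned model, then `L ∈ BQPWith (yaoGateSet M D) (1/3)`. [cite: NishimuraOzawa2002, Thm. 4.3 and Thm. 5.2 (proof)] -/
theorem mem_BQPWith_yaoGateSet {M : QTM} {D : M.Λ → Dir} (hD : M.IsUnidirectionalWith D)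
    {p : Polynomial ℕ} {L : Language Bool}
    (hL : ∀ x : List Bool, (x ∈ L → (2 / 3 : ℝ) ≤ M.pacceptProbAt x (p.eval x.length)) ∧
      (x ∉ L → M.pacceptProbAt x (p.eval x.length) ≤ (1 / 3 : ℝ))) :
    L ∈ BQPWith (yaoGateSet M D) (1 / 3) := by
  refine ⟨yaoFamily M D p, isOracleFree_yaoFamily D p, isUniform_yaoFamily M D p, fun x => ?_⟩
  rw [acceptProbOn_yaoFamily D hD p x]
  refine ⟨fun hx => ?_, fun hx => (hL x).2 hx⟩
  have := (hL x).1 hx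
  linarith

/-- **`BQPQTMPos ⊆ BQP` from the unidirection lemma and the effective Solovay–Kitaev theorem**
(Nishimura–Ozawa 2002, Thm. 5.2, inclusion `BQP ⊆ BUPQC`, in Bernstein–Vazirani's model).
Hypotheses:
* `hUni` — Bernstein–Vazirani 1997, Lemma 5.5 (unidirection lemma) in the form needed here:
  every BV-well-formed machine with polynomial-time computable amplitudes, observed at a
  polynomial time, has the acceptance probabilities of some UNIDIRECTIONAL BV-well-formed machine
  with polynomial-time computable amplitudes observed at a polynomial time;
* `hSK` — the effective Solovay–Kitaev theorem exactly as in `BQPOver_eq_BQP_of`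
  (`BQPGateSetIndependence.lean`; Dawson–Nielsen 2006, Thm. 1).
Proof: `hUni`, then `mem_BQPWith_yaoGateSet` (Thm. 4.3, proved), the gate set being finite,
unitary (`yaoGateSet_isUnitary_of_pIsWellFormed`) with polynomial-time computable entries
(`yaoGateSet_polyTimeEntries`); compile into Clifford+`T` along `hSK`
(`BQPWith_subset_BQPWith_of_compiler` with `GateCompiler.uniformSubst_of_polyTime`,
`cliffordT_isUniversal_holds`, `cliffordT_isInverseClosed`, `cliffordT_polyTimeEntries`) at the
cost of error `1/12`, and `BQPWith cliffordT (5/12) = BQP` (`BQP_eq_BQPWith_holds`). [cite: NishimuraOzawa2002, Thm. 5.2] -/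
theorem BQPQTMPos_subset_BQP_of_unidirection_of_SK
    (hUni : ∀ (M : QTM) (p : Polynomial ℕ), M.PIsWellFormed → M.amplitudes ⊆ polyTimeComputableComplex →
      ∃ (M' : QTM) (D : M'.Λ → Dir) (p' : Polynomial ℕ), M'.IsUnidirectionalWith D ∧ M'.PIsWellFormed ∧
        M'.amplitudes ⊆ polyTimeComputableComplex ∧
          ∀ x : List Bool, M'.pacceptProbAt x (p'.eval x.length) = M.pacceptProbAt x (p.eval x.length))
    (hSK : ∀ (G₁ G₂ : QGateSet) [Finite G₁.Op] [Encodable G₁.Op] [Finite G₂.Op] [Encodable G₂.Op],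
      G₁.IsUnitary →
      (∀ (g : G₁.Op) (i j : QReg (G₁.arity g)), G₁.mat g i j ∈ polyTimeComputableComplex) →
      G₂.IsUnitary → G₂.IsUniversal → G₂.IsInverseClosed →
      (∀ (g : G₂.Op) (i j : QReg (G₂.arity g)), G₂.mat g i j ∈ polyTimeComputableComplex) →
      ∃ W : GateCompiler G₁ G₂, W.Sound ∧ W.PolyTime) :
    BQPQTMPos ⊆ BQP := by
  rintro L ⟨M, p, hwf, hamp, hL⟩
  obtain ⟨M', D, p', hD, hwf', hamp', hsim⟩ := hUni M p hwf hamp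
  have hL' : L ∈ BQPWith (yaoGateSet M' D) (1 / 3) :=
    mem_BQPWith_yaoGateSet hD fun x => by rw [hsim x]; exact hL x
  have hGU : (yaoGateSet M' D).IsUnitary := yaoGateSet_isUnitary_of_pIsWellFormed hD hwf'
  obtain ⟨W, hW, hWp⟩ := hSK (yaoGateSet M' D) cliffordT hGU (yaoGateSet_polyTimeEntries hamp')
    cliffordT_isUnitary_holds cliffordT_isUniversal_holds cliffordT_isInverseClosed cliffordT_polyTimeEntries
  have h := BQPWith_subset_BQPWith_of_compiler hGU cliffordT_isUnitary_holds W hW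
    (W.uniformSubst_of_polyTime hWp) (1 / 3) (by norm_num : (0 : ℝ) < 1 / 12) hL'
  rwa [BQP_eq_BQPWith_holds (ε := 1 / 3 + 1 / 12) (by norm_num) (by norm_num)] at h

/-- **The faithful S04, `BQPQTMPos = BQP`, from three printed results** (Nishimura–Ozawa 2002,
Thm. 5.2 `BQP = BUPQC`, in Bernstein–Vazirani's model): `hUni` (BV 1997, Lemma 5.5) and `hSK`
(effective Solovay–Kitaev) give `⊆` (`BQPQTMPos_subset_BQP_of_unidirection_of_SK`, through the proved Thm. 4.3),
and the positioned, head-oblivious form `hNOpos` of Nishimura–Ozawa's Lemma 5.1 gives `⊇`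
(`BQP_subset_BQPQTM_of_positioned`, `QuantumTuringPositionedGlue.lean`). [cite: NishimuraOzawa2002, Thm. 5.2] -/
theorem BQPQTMPos_eq_BQP_of_unidirection_SK_NO
    (hUni : ∀ (M : QTM) (p : Polynomial ℕ), M.PIsWellFormed → M.amplitudes ⊆ polyTimeComputableComplex →
      ∃ (M' : QTM) (D : M'.Λ → Dir) (p' : Polynomial ℕ), M'.IsUnidirectionalWith D ∧ M'.PIsWellFormed ∧
        M'.amplitudes ⊆ polyTimeComputableComplex ∧
          ∀ x : List Bool, M'.pacceptProbAt x (p'.eval x.length) = M.pacceptProbAt x (p.eval x.length))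
    (hSK : ∀ (G₁ G₂ : QGateSet) [Finite G₁.Op] [Encodable G₁.Op] [Finite G₂.Op] [Encodable G₂.Op],
      G₁.IsUnitary →
      (∀ (g : G₁.Op) (i j : QReg (G₁.arity g)), G₁.mat g i j ∈ polyTimeComputableComplex) →
      G₂.IsUnitary → G₂.IsUniversal → G₂.IsInverseClosed →
      (∀ (g : G₂.Op) (i j : QReg (G₂.arity g)), G₂.mat g i j ∈ polyTimeComputableComplex) →
      ∃ W : GateCompiler G₁ G₂, W.Sound ∧ W.PolyTime)
    (hNOpos : ∀ F : QCircuitFamily cliffordT, F.IsOracleFree → F.IsUniform →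
      ∃ (M : QTM) (q : Polynomial ℕ), M.PIsWellFormed ∧
        M.amplitudes ⊆ polyTimeComputableComplex ∧
          (∀ x : List Bool, ∃ ξ : ℤ,
            ∀ c ∈ (M.pstateAt x (q.eval x.length)).support, c.2 = ξ) ∧
          ∀ x : List Bool, M.pacceptProbAt x (q.eval x.length) = F.acceptProbOn 0 x) :
    BQPQTMPos = BQP :=
  Set.Subset.antisymm (BQPQTMPos_subset_BQP_of_unidirection_of_SK hUni hSK)
    (BQP_subset_BQPQTM_of_positioned hNOpos).2

/-- The same two hypotheses `hUni`, `hSK` together with `hNOpos` also give the inclusion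
`BQP ⊆ BQPQTM` of the TREE's statement `BQPQTM_eq_BQP` (the printed stationary construction is
insensitive to the model caveat, `BQP_subset_BQPQTM_of_positioned`); the converse inclusion for the
tree's translation-quotient semantics is not covered by the sources (see `QuantumTuring.lean`,
"Model caveat"). [cite: NishimuraOzawa2002, Lemma 5.1 and Thm. 5.2] -/
theorem BQP_subset_BQPQTM_and_BQPQTMPos_eq_BQP_of_unidirection_SK_NO
    (hUni : ∀ (M : QTM) (p : Polynomial ℕ), M.PIsWellFormed → M.amplitudes ⊆ polyTimeComputableComplex →
      ∃ (M' : QTM) (D : M'.Λ → Dir) (p' : Polynomial ℕ), M'.IsUnidirectionalWith D ∧ M'.PIsWellFormed ∧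
        M'.amplitudes ⊆ polyTimeComputableComplex ∧
          ∀ x : List Bool, M'.pacceptProbAt x (p'.eval x.length) = M.pacceptProbAt x (p.eval x.length))
    (hSK : ∀ (G₁ G₂ : QGateSet) [Finite G₁.Op] [Encodable G₁.Op] [Finite G₂.Op] [Encodable G₂.Op],
      G₁.IsUnitary →
      (∀ (g : G₁.Op) (i j : QReg (G₁.arity g)), G₁.mat g i j ∈ polyTimeComputableComplex) →
      G₂.IsUnitary → G₂.IsUniversal → G₂.IsInverseClosed →
      (∀ (g : G₂.Op) (i j : QReg (G₂.arity g)), G₂.mat g i j ∈ polyTimeComputableComplex) →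
      ∃ W : GateCompiler G₁ G₂, W.Sound ∧ W.PolyTime)
    (hNOpos : ∀ F : QCircuitFamily cliffordT, F.IsOracleFree → F.IsUniform →
      ∃ (M : QTM) (q : Polynomial ℕ), M.PIsWellFormed ∧
        M.amplitudes ⊆ polyTimeComputableComplex ∧
          (∀ x : List Bool, ∃ ξ : ℤ,
            ∀ c ∈ (M.pstateAt x (q.eval x.length)).support, c.2 = ξ) ∧
          ∀ x : List Bool, M.pacceptProbAt x (q.eval x.length) = F.acceptProbOn 0 x) :
    BQP ⊆ BQPQTM ∧ BQPQTMPos = BQP :=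
  ⟨(BQP_subset_BQPQTM_of_positioned hNOpos).1, BQPQTMPos_eq_BQP_of_unidirection_SK_NO hUni hSK hNOpos⟩

/-- **`BQPQTMPos ⊆ BQP` from the effective Solovay–Kitaev theorem alone** (Nishimura–Ozawa
2002, Thm. 5.2, inclusion `BQP ⊆ BUPQC`, in Bernstein–Vazirani's model): the unidirection
hypothesis of `BQPQTMPos_subset_BQP_of_unidirection_of_SK` is the tree theorem
`QTM.unidirection` (BV 1997, Lemma 5.5). [cite: NishimuraOzawa2002, Thm. 5.2] -/
theorem BQPQTMPos_subset_BQP_of_SK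
    (hSK : ∀ (G₁ G₂ : QGateSet) [Finite G₁.Op] [Encodable G₁.Op] [Finite G₂.Op] [Encodable G₂.Op],
      G₁.IsUnitary →
      (∀ (g : G₁.Op) (i j : QReg (G₁.arity g)), G₁.mat g i j ∈ polyTimeComputableComplex) →
      G₂.IsUnitary → G₂.IsUniversal → G₂.IsInverseClosed →
      (∀ (g : G₂.Op) (i j : QReg (G₂.arity g)), G₂.mat g i j ∈ polyTimeComputableComplex) →
      ∃ W : GateCompiler G₁ G₂, W.Sound ∧ W.PolyTime) :
    BQPQTMPos ⊆ BQP :=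
  BQPQTMPos_subset_BQP_of_unidirection_of_SK QTM.unidirection hSK

/-- **The faithful S04 from two printed results**: `BQPQTMPos = BQP` from the effective
Solovay–Kitaev theorem `hSK` (for `⊆`, through the proved Thm. 4.3 and the proved unidirection
lemma) and the positioned, head-oblivious form `hNOpos` of Nishimura–Ozawa's Lemma 5.1 (for `⊇`). [cite: NishimuraOzawa2002, Thm. 5.2] -/
theorem BQPQTMPos_eq_BQP_of_SK_NO
    (hSK : ∀ (G₁ G₂ : QGateSet) [Finite G₁.Op] [Encodable G₁.Op] [Finite G₂.Op] [Encodable G₂.Op],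
      G₁.IsUnitary →
      (∀ (g : G₁.Op) (i j : QReg (G₁.arity g)), G₁.mat g i j ∈ polyTimeComputableComplex) →
      G₂.IsUnitary → G₂.IsUniversal → G₂.IsInverseClosed →
      (∀ (g : G₂.Op) (i j : QReg (G₂.arity g)), G₂.mat g i j ∈ polyTimeComputableComplex) →
      ∃ W : GateCompiler G₁ G₂, W.Sound ∧ W.PolyTime)
    (hNOpos : ∀ F : QCircuitFamily cliffordT, F.IsOracleFree → F.IsUniform →
      ∃ (M : QTM) (q : Polynomial ℕ), M.PIsWellFormed ∧
        M.amplitudes ⊆ polyTimeComputableComplex ∧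
          (∀ x : List Bool, ∃ ξ : ℤ,
            ∀ c ∈ (M.pstateAt x (q.eval x.length)).support, c.2 = ξ) ∧
          ∀ x : List Bool, M.pacceptProbAt x (q.eval x.length) = F.acceptProbOn 0 x) :
    BQPQTMPos = BQP :=
  BQPQTMPos_eq_BQP_of_unidirection_SK_NO QTM.unidirection hSK hNOpos

/-- With `hSK` and `hNOpos`: the inclusion `BQP ⊆ BQPQTM` of the TREE's statement and the
faithful equality `BQPQTMPos = BQP`. [cite: NishimuraOzawa2002, Lemma 5.1 and Thm. 5.2] -/
theorem BQP_subset_BQPQTM_and_BQPQTMPos_eq_BQP_of_SK_NO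
    (hSK : ∀ (G₁ G₂ : QGateSet) [Finite G₁.Op] [Encodable G₁.Op] [Finite G₂.Op] [Encodable G₂.Op],
      G₁.IsUnitary →
      (∀ (g : G₁.Op) (i j : QReg (G₁.arity g)), G₁.mat g i j ∈ polyTimeComputableComplex) →
      G₂.IsUnitary → G₂.IsUniversal → G₂.IsInverseClosed →
      (∀ (g : G₂.Op) (i j : QReg (G₂.arity g)), G₂.mat g i j ∈ polyTimeComputableComplex) →
      ∃ W : GateCompiler G₁ G₂, W.Sound ∧ W.PolyTime)
    (hNOpos : ∀ F : QCircuitFamily cliffordT, F.IsOracleFree → F.IsUniform →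
      ∃ (M : QTM) (q : Polynomial ℕ), M.PIsWellFormed ∧
        M.amplitudes ⊆ polyTimeComputableComplex ∧
          (∀ x : List Bool, ∃ ξ : ℤ,
            ∀ c ∈ (M.pstateAt x (q.eval x.length)).support, c.2 = ξ) ∧
          ∀ x : List Bool, M.pacceptProbAt x (q.eval x.length) = F.acceptProbOn 0 x) :
    BQP ⊆ BQPQTM ∧ BQPQTMPos = BQP :=
  BQP_subset_BQPQTM_and_BQPQTMPos_eq_BQP_of_unidirection_SK_NO QTM.unidirection hSK hNOpos

/-! ### Unconditional: `BQPQTMPos ⊆ BQP` -/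

/-- **`BQPQTMPos ⊆ BQP`, unconditionally** — Nishimura–Ozawa 2002, Thm. 5.2, inclusion
`BQP ⊆ BUPQC`, for Bernstein–Vazirani's own (positioned) machine model: a BV-well-formed
polynomial-time QTM with `C̃` amplitudes is made unidirectional (`QTM.unidirection`, BV Lemma 5.5),
simulated EXACTLY by a uniform family over Clifford+`T` ∪ {its local unitary} (Thm. 4.3,
`qtm_uniformCircuitFamily_of_unidirectional`), whose languages pass to Clifford+`T` through the
tree's effective compiler (`exists_sound_expTime_compiler`, Dawson–Nielsen) at logarithmic
accuracy level (`PromiseBQPWith_subset_of_expTime`) and error reduction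
(`PromiseBQPWith_eq_PromiseBQP`), via the promise-class bridges `ofLanguage_mem_PromiseBQPOver_iff`
/ `ofLanguage_mem_PromiseBQP_iff`. [cite: NishimuraOzawa2002, Thm. 5.2] -/
theorem BQPQTMPos_subset_BQP : BQPQTMPos ⊆ BQP := by
  rintro L ⟨M, p, hwf, hamp, hL⟩
  obtain ⟨M', D, p', hD, hwf', hamp', hsim⟩ := QTM.unidirection M p hwf hamp
  have hL' : L ∈ BQPWith (yaoGateSet M' D) (1 / 3) :=
    mem_BQPWith_yaoGateSet hD fun x => by rw [hsim x]; exact hL x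
  have hGU : (yaoGateSet M' D).IsUnitary := yaoGateSet_isUnitary_of_pIsWellFormed hD hwf'
  obtain ⟨W, hW, hWe⟩ := exists_sound_expTime_compiler (yaoGateSet M' D) cliffordT hGU
    (yaoGateSet_polyTimeEntries hamp') cliffordT_isUnitary_holds cliffordT_isUniversal_holds
    cliffordT_isInverseClosed cliffordT_polyTimeEntries
  have hP : Complexity.PromiseProblem.ofLanguage L ∈ PromiseBQPWith (yaoGateSet M' D) (1 / 3) := by
    rw [PromiseBQPWith_one_third]
    exact ofLanguage_mem_PromiseBQPOver_iff.mpr hL'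
  have h := PromiseBQPWith_subset_of_expTime hGU cliffordT_isUnitary_holds W hW hWe (1 / 3)
    (by norm_num : (0 : ℝ) < 1 / 12) hP
  rw [PromiseBQPWith_eq_PromiseBQP (ε := 1 / 3 + 1 / 12) (by norm_num) (by norm_num)] at h
  exact ofLanguage_mem_PromiseBQP_iff.mp h

/-- **The faithful S04 from Nishimura–Ozawa's Lemma 5.1 alone**: `BQPQTMPos = BQP` for the
positioned, head-oblivious form `hNOpos` of Lemma 5.1 (`⊇`, `BQP_subset_BQPQTM_of_positioned`),
`⊆` being `BQPQTMPos_subset_BQP`. [cite: NishimuraOzawa2002, Thm. 5.2] -/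
theorem BQPQTMPos_eq_BQP_of_NO
    (hNOpos : ∀ F : QCircuitFamily cliffordT, F.IsOracleFree → F.IsUniform →
      ∃ (M : QTM) (q : Polynomial ℕ), M.PIsWellFormed ∧
        M.amplitudes ⊆ polyTimeComputableComplex ∧
          (∀ x : List Bool, ∃ ξ : ℤ,
            ∀ c ∈ (M.pstateAt x (q.eval x.length)).support, c.2 = ξ) ∧
          ∀ x : List Bool, M.pacceptProbAt x (q.eval x.length) = F.acceptProbOn 0 x) :
    BQPQTMPos = BQP :=
  Set.Subset.antisymm BQPQTMPos_subset_BQP (BQP_subset_BQPQTM_of_positioned hNOpos).2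

/-- With `hNOpos` alone: `BQP ⊆ BQPQTM` for the TREE's statement and the faithful equality
`BQPQTMPos = BQP`; together with the tree theorem `BQPQTM_subset_BQP`
(`QuantumTuringADHGateSet.lean`) the former closes `BQPQTM_eq_BQP`. [cite: NishimuraOzawa2002, Lemma 5.1 and Thm. 5.2] -/
theorem BQP_subset_BQPQTM_and_BQPQTMPos_eq_BQP_of_NO
    (hNOpos : ∀ F : QCircuitFamily cliffordT, F.IsOracleFree → F.IsUniform →
      ∃ (M : QTM) (q : Polynomial ℕ), M.PIsWellFormed ∧
        M.amplitudes ⊆ polyTimeComputableComplex ∧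
          (∀ x : List Bool, ∃ ξ : ℤ,
            ∀ c ∈ (M.pstateAt x (q.eval x.length)).support, c.2 = ξ) ∧
          ∀ x : List Bool, M.pacceptProbAt x (q.eval x.length) = F.acceptProbOn 0 x) :
    BQP ⊆ BQPQTM ∧ BQPQTMPos = BQP :=
  ⟨(BQP_subset_BQPQTM_of_positioned hNOpos).1, BQPQTMPos_eq_BQP_of_NO hNOpos⟩

end Literature.Computability.QuantumComplexity

end
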